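/-
Fleet lead `ym-wcr-19609-p1` (seat prover-ym-wcr-19609-p1-g2-0), route `WeakCouplingRates`, crux `BulkDominatesColdBoxW`
(stmt-QuantumFields-19609), line `dlr-chessboard` (v4): the kernel-checked REDUCTION of stub L1a (census v3, item evidence #12).
-/
import Summits.QuantumFields.YangMills.Theorems.WeakCouplingRatesBulkDominatesColdBoxWMeanSmoothOfExpansion

/-!
# Crux `BulkDominatesColdBoxW`: stub L1a `stub_goodBoundaryCovStable` REDUCED to the one-scale kernel covariance expansion (N2-cov),
# its flat twin (= the sibling crux's S3c) and the size of the Dirichlet two-point kernel (N1) — exponent bookkeeping kernel-checked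

Along the registered family `(A, δ) = (θ/20, θ/5)`, at the pair `p = (centre; 1,2)`, `q = p + ⌈β^A⌉e₀` of the cold box `H = ⌈β^θ⌉`: IF
(N2-cov) for every crude-good `ω`, `β²·Cov_ω(c_p,c_q) = (3/2)·C_D² + 2β·⟨F̄_p, F̄_q⟩·C_D ± β^{−θ/2}` with one-colour data of total energy
`≤ 16(2H+3)⁴β^{2δ−1}`; IF (flat) `β²·Cov_1 = (3/2)·C_D² ± β^{−θ/2}` (no background); and IF (N1) `κ′/⌈β^A⌉⁴ ≤ C_D ≤ 1`; THEN
`GoodBoundaryCovStable (θ/20) θ (θ/5) (1/2)`: `Cov_ω ≥ ½·Cov_1`.  Mechanism (census v3 §3): polarisation `2⟨F̄_p,F̄_q⟩ ≥ −|F̄_p − F̄_q|²`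
and the interior GRADIENT bound telescoped over the `⌈β^A⌉` steps (`dirBackground_interior_bounds`) give a negative background term of size
`≤ 10⁴C²·β^{2δ}(T/H)²·C_D ≤ (3/8)C_D²` and `(3/2)β^{−θ/2} ≤ (3/8)C_D²` once `β^{1.3θ}` and `β^{0.1θ}` beat explicit constants.  The three
interfaces are UNFOLDED here (named forms `KernelCovExpansion` / `FlatCovExpansion` / `DirKernelTwoPoint` in `…BulkDominatesColdBoxWDefs.lean`);
the named corollary is one line.  No new definition; standard axioms.  NOT a claim about the mass gap.
-/

set_option autoImplicit false

noncomputable section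

open MeasureTheory Finset Matrix
open Literature.Probability.LatticeModels
open Literature.MathematicalPhysics.QuantumLattice
open Literature.MathematicalPhysics.QuantumFieldTheory
open Literature.MathematicalPhysics.QuantumFieldTheory.LatticeMaxwell
open Literature.MathematicalPhysics.QuantumFieldTheory.AxialGauge
open Literature.MathematicalPhysics.QuantumFieldTheory.LatticeChain
open Literature.MathematicalPhysics.QuantumFieldTheory.LatticeForm (e d₁ d₁_swap)

namespace Summit.QuantumFields.YangMills.Theorems.WeakCouplingRates

/-- Polarisation: `2ab ≥ −(b − a)²`. -/
theorem two_mul_mul_ge_neg_sq (a b : ℝ) : -((b - a) ^ 2) ≤ 2 * (a * b) := by nlinarith [sq_nonneg (a + b)]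

/-- Telescoping a uniform step bound: `|f T − f 0| ≤ T·Q` if `|f (t+1) − f t| ≤ Q` for `t < T`. -/
theorem abs_sub_le_mul_of_steps (f : ℕ → ℝ) (T : ℕ) (Q : ℝ) (h : ∀ t : ℕ, t + 1 ≤ T → |f (t + 1) - f t| ≤ Q) :
    |f T - f 0| ≤ (T : ℝ) * Q := by
  rw [← Finset.sum_range_sub f T]
  refine (Finset.abs_sum_le_sum_abs _ _).trans ?_
  calc ∑ i ∈ Finset.range T, |f (i + 1) - f i| ≤ ∑ _i ∈ Finset.range T, Q :=
        Finset.sum_le_sum fun i hi => h i (by have := Finset.mem_range.1 hi; omega)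
    _ = (T : ℝ) * Q := by rw [Finset.sum_const, Finset.card_range, nsmul_eq_mul]

/-- **L1a ⇐ N2-cov ∧ flat ∧ N1**, with the three interfaces unfolded; see the module docstring. -/
theorem goodBoundaryCovStable_of_expansion_explicit {θ₂ : ℝ} (hθ₂ : 0 < θ₂)
    (hexp : ∀ θ : ℝ, 0 < θ → θ ≤ θ₂ →
      ∃ β₀ : ℝ, ∀ β : ℝ, β₀ ≤ β → ∀ ω : LGConfig 4 (Matrix.specialUnitaryGroup (Fin 2) ℂ), CrudeGood β (θ / 5) ⌈β ^ θ⌉₊ ω →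
        ∃ ϑ : Fin 3 → (Literature.MathematicalPhysics.QuantumLattice.ZdEdge 4 → ℝ), ∃ s : Fin 3 → (DirFree ⌈β ^ θ⌉₊ → ℝ),
          (∑ c, LatticeMaxwell.formM (fun e => e ∉ dirFreeEdges ⌈β ^ θ⌉₊) dirCorner (2 * ⌈β ^ θ⌉₊ + 3) (ϑ c) (s c) ≤
              16 * (2 * (⌈β ^ θ⌉₊ : ℝ) + 3) ^ 4 * β ^ (2 * (θ / 5) - 1)) ∧
          |β ^ 2 * ((∫ U, plaqCostAt (fundamentalRep (Fin 2)) (boxCentre ⌈β ^ θ⌉₊) 1 2 U *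
                  plaqCostAt (fundamentalRep (Fin 2)) (boxCentre ⌈β ^ θ⌉₊ + Pi.single 0 (⌈β ^ (θ / 20)⌉₊ : ℤ)) 1 2 U
                    ∂(boxKernel β ⌈β ^ θ⌉₊ ω)) -
                (∫ U, plaqCostAt (fundamentalRep (Fin 2)) (boxCentre ⌈β ^ θ⌉₊) 1 2 U ∂(boxKernel β ⌈β ^ θ⌉₊ ω)) *
                  (∫ U, plaqCostAt (fundamentalRep (Fin 2)) (boxCentre ⌈β ^ θ⌉₊ + Pi.single 0 (⌈β ^ (θ / 20)⌉₊ : ℤ)) 1 2 U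
                    ∂(boxKernel β ⌈β ^ θ⌉₊ ω))) -
              3 / 2 * boxDirProjKernel ⌈β ^ θ⌉₊ (boxCentre ⌈β ^ θ⌉₊, 1, 2)
                (boxCentre ⌈β ^ θ⌉₊ + Pi.single 0 (⌈β ^ (θ / 20)⌉₊ : ℤ), 1, 2) ^ 2 -
              2 * β * (∑ c,
                  LatticeMaxwell.sCirc (LatticeMaxwell.glue (pin := fun e => e ∉ dirFreeEdges ⌈β ^ θ⌉₊) dirCorner (2 * ⌈β ^ θ⌉₊ + 3)
                      (ϑ c) (LatticeMaxwell.mean (fun e => e ∉ dirFreeEdges ⌈β ^ θ⌉₊) dirCorner (2 * ⌈β ^ θ⌉₊ + 3) (ϑ c)))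
                    (boxCentre ⌈β ^ θ⌉₊, 1, 2) *
                  LatticeMaxwell.sCirc (LatticeMaxwell.glue (pin := fun e => e ∉ dirFreeEdges ⌈β ^ θ⌉₊) dirCorner (2 * ⌈β ^ θ⌉₊ + 3)
                      (ϑ c) (LatticeMaxwell.mean (fun e => e ∉ dirFreeEdges ⌈β ^ θ⌉₊) dirCorner (2 * ⌈β ^ θ⌉₊ + 3) (ϑ c)))
                    (boxCentre ⌈β ^ θ⌉₊ + Pi.single 0 (⌈β ^ (θ / 20)⌉₊ : ℤ), 1, 2)) *
                boxDirProjKernel ⌈β ^ θ⌉₊ (boxCentre ⌈β ^ θ⌉₊, 1, 2) (boxCentre ⌈β ^ θ⌉₊ + Pi.single 0 (⌈β ^ (θ / 20)⌉₊ : ℤ), 1, 2)|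
            ≤ β ^ (-(θ / 2)))
    (hflat : ∀ θ : ℝ, 0 < θ → θ ≤ θ₂ → ∃ β₀ : ℝ, ∀ β : ℝ, β₀ ≤ β →
      |β ^ 2 * boxPlaqCov (fundamentalRep (Fin 2)) β ⌈β ^ θ⌉₊ ⌈β ^ (θ / 20)⌉₊ -
          3 / 2 * boxDirProjKernel ⌈β ^ θ⌉₊ (boxCentre ⌈β ^ θ⌉₊, 1, 2)
            (boxCentre ⌈β ^ θ⌉₊ + Pi.single 0 (⌈β ^ (θ / 20)⌉₊ : ℤ), 1, 2) ^ 2| ≤ β ^ (-(θ / 2)))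
    (hker : ∀ θ : ℝ, 0 < θ → θ ≤ θ₂ → ∃ κ' : ℝ, 0 < κ' ∧ ∃ β₀ : ℝ, ∀ β : ℝ, β₀ ≤ β →
      κ' / (⌈β ^ (θ / 20)⌉₊ : ℝ) ^ 4 ≤
          boxDirProjKernel ⌈β ^ θ⌉₊ (boxCentre ⌈β ^ θ⌉₊, 1, 2) (boxCentre ⌈β ^ θ⌉₊ + Pi.single 0 (⌈β ^ (θ / 20)⌉₊ : ℤ), 1, 2) ∧
        boxDirProjKernel ⌈β ^ θ⌉₊ (boxCentre ⌈β ^ θ⌉₊, 1, 2) (boxCentre ⌈β ^ θ⌉₊ + Pi.single 0 (⌈β ^ (θ / 20)⌉₊ : ℤ), 1, 2) ≤ 1) :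
    ∃ θ₁ : ℝ, 0 < θ₁ ∧ ∀ θ : ℝ, 0 < θ → θ ≤ θ₁ → ∃ η₁ : ℝ, 0 < η₁ ∧ GoodBoundaryCovStable (θ / 20) θ (θ / 5) η₁ := by
  obtain ⟨C, hC0, hI⟩ := dirBackground_interior_bounds
  refine ⟨θ₂, hθ₂, fun θ hθ hθle => ⟨1 / 2, by norm_num, ?_⟩⟩
  obtain ⟨β₁, hE⟩ := hexp θ hθ hθle
  obtain ⟨β₂, hF⟩ := hflat θ hθ hθle
  obtain ⟨κ', hκ', β₃, hK⟩ := hker θ hθ hθle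
  set A : ℝ := θ / 20 with hA
  set δ : ℝ := θ / 5 with hδ
  have hA0 : 0 < A := by rw [hA]; positivity
  have hAθ : 0 < θ - A := by rw [hA]; linarith
  have h13 : 0 < 13 / 10 * θ := by positivity
  have h01 : 0 < θ / 10 := by positivity
  -- constants of the two final comparisons
  set L₁ : ℝ := 64 * 10000 * C ^ 2 * 8 / (3 * κ') + 1 with hL₁
  set L₂ : ℝ := 1024 / κ' ^ 2 with hL₂
  have hL₁0 : 0 ≤ L₁ := by rw [hL₁]; positivity
  have hL₂0 : 0 ≤ L₂ := by rw [hL₂]; positivity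
  refine ⟨max (max (max β₁ β₂) (max β₃ 1)) (max (max ((8 : ℝ) ^ (1 / θ)) ((16 : ℝ) ^ (1 / (θ - A))))
      (max (L₁ ^ (1 / (13 / 10 * θ))) (L₂ ^ (1 / (θ / 10))))), fun β hβ ω hω => ?_⟩
  -- unpack the thresholds
  have hβ₁ : β₁ ≤ β := le_trans (le_trans (le_trans (le_max_left _ _) (le_max_left _ _)) (le_max_left _ _)) hβ
  have hβ₂ : β₂ ≤ β := le_trans (le_trans (le_trans (le_max_right _ _) (le_max_left _ _)) (le_max_left _ _)) hβ
  have hβ₃ : β₃ ≤ β := le_trans (le_trans (le_trans (le_max_left _ _) (le_max_right _ _)) (le_max_left _ _)) hβ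
  have hβ1 : (1 : ℝ) ≤ β := le_trans (le_trans (le_trans (le_max_right _ _) (le_max_right _ _)) (le_max_left _ _)) hβ
  have hβ0 : 0 < β := by linarith
  have h8β : (8 : ℝ) ≤ β ^ θ := le_rpow_of_root_le (by norm_num) hθ
    (le_trans (le_trans (le_trans (le_max_left _ _) (le_max_left _ _)) (le_max_right _ _)) hβ)
  have h16 : (16 : ℝ) ≤ β ^ (θ - A) := le_rpow_of_root_le (by norm_num) hAθ
    (le_trans (le_trans (le_trans (le_max_right _ _) (le_max_left _ _)) (le_max_right _ _)) hβ)
  have hL₁β : L₁ ≤ β ^ (13 / 10 * θ) := le_rpow_of_root_le hL₁0 h13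
    (le_trans (le_trans (le_trans (le_max_left _ _) (le_max_right _ _)) (le_max_right _ _)) hβ)
  have hL₂β : L₂ ≤ β ^ (θ / 10) := le_rpow_of_root_le hL₂0 h01
    (le_trans (le_trans (le_trans (le_max_right _ _) (le_max_right _ _)) (le_max_right _ _)) hβ)
  set H : ℕ := ⌈β ^ θ⌉₊ with hHdef
  set T : ℕ := ⌈β ^ A⌉₊ with hTdef
  -- the data
  obtain ⟨ϑ, s, henergy, hcov⟩ := hE β hβ₁ ω hω
  have hFβ := hF β hβ₂
  obtain ⟨hCDlow, hCDle⟩ := hK β hβ₃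
  obtain ⟨hT1, hT2⟩ := one_le_ceil_rpow_and_le hβ1 hA0.le
  obtain ⟨hH1, hH2⟩ := one_le_ceil_rpow_and_le hβ1 hθ.le
  rw [← hTdef] at hT1 hT2
  rw [← hHdef] at hH1 hH2
  have hHceil : β ^ θ ≤ (H : ℝ) := Nat.le_ceil _
  have hH8 : 8 ≤ H := by
    have : (8 : ℝ) ≤ H := h8β.trans hHceil
    exact_mod_cast this
  have hHpos : (0 : ℝ) < H := by linarith
  have hTpos : (0 : ℝ) < T := by linarith
  have h8T : 8 * T ≤ H := by
    have h1 : (8 : ℝ) * T ≤ 16 * β ^ A := by linarith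
    have h2 : (16 : ℝ) * β ^ A ≤ β ^ θ := by
      have : β ^ θ = β ^ (θ - A) * β ^ A := by rw [← Real.rpow_add hβ0]; ring_nf
      rw [this]; exact mul_le_mul_of_nonneg_right h16 (Real.rpow_nonneg hβ0.le _)
    have : (8 : ℝ) * T ≤ H := h1.trans (h2.trans hHceil)
    exact_mod_cast this
  -- opaque abbreviations (no `set`: the objects are large)
  obtain ⟨Fb, hFb⟩ : ∃ Fb : Fin 3 → Site 4 → ℝ, Fb = fun c x =>
      LatticeMaxwell.sCirc (LatticeMaxwell.glue (pin := fun e => e ∉ dirFreeEdges H) dirCorner (2 * H + 3) (ϑ c)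
        (LatticeMaxwell.mean (fun e => e ∉ dirFreeEdges H) dirCorner (2 * H + 3) (ϑ c))) (x, 1, 2) := ⟨_, rfl⟩
  obtain ⟨Ec, hEc⟩ : ∃ Ec : Fin 3 → ℝ, Ec = fun c =>
      LatticeMaxwell.formM (fun e => e ∉ dirFreeEdges H) dirCorner (2 * H + 3) (ϑ c) (s c) := ⟨_, rfl⟩
  obtain ⟨CD, hCD⟩ : ∃ CD : ℝ, CD = boxDirProjKernel H (boxCentre H, 1, 2) (boxCentre H + Pi.single 0 (T : ℤ), 1, 2) := ⟨_, rfl⟩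
  obtain ⟨Covω, hCovω⟩ : ∃ Covω : ℝ, Covω =
      (∫ U, plaqCostAt (fundamentalRep (Fin 2)) (boxCentre H) 1 2 U *
          plaqCostAt (fundamentalRep (Fin 2)) (boxCentre H + Pi.single 0 (T : ℤ)) 1 2 U ∂(boxKernel β H ω)) -
        (∫ U, plaqCostAt (fundamentalRep (Fin 2)) (boxCentre H) 1 2 U ∂(boxKernel β H ω)) *
          (∫ U, plaqCostAt (fundamentalRep (Fin 2)) (boxCentre H + Pi.single 0 (T : ℤ)) 1 2 U ∂(boxKernel β H ω)) := ⟨_, rfl⟩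
  obtain ⟨Cov1, hCov1⟩ : ∃ Cov1 : ℝ, Cov1 = boxPlaqCov (fundamentalRep (Fin 2)) β H T := ⟨_, rfl⟩
  set B : ℝ := ∑ c, Fb c (boxCentre H) * Fb c (boxCentre H + Pi.single 0 (T : ℤ)) with hB
  have hcov' : |β ^ 2 * Covω - 3 / 2 * CD ^ 2 - 2 * β * B * CD| ≤ β ^ (-(θ / 2)) := by
    rw [hB, hCovω, hCD, hFb]; exact hcov
  have hFβ' : |β ^ 2 * Cov1 - 3 / 2 * CD ^ 2| ≤ β ^ (-(θ / 2)) := by rw [hCov1, hCD]; exact hFβ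
  have hCDlow' : κ' / (T : ℝ) ^ 4 ≤ CD := by rw [hCD]; exact hCDlow
  have hEsum : ∑ c, Ec c ≤ 16 * (2 * (H : ℝ) + 3) ^ 4 * β ^ (2 * δ - 1) := by rw [hEc]; exact henergy
  have hEc0 : ∀ c, 0 ≤ Ec c := fun c => by
    rw [hEc]; simp only [LatticeMaxwell.formM]; exact Finset.sum_nonneg fun p _ => sq_nonneg _
  set xt : ℕ → Site 4 := fun t => boxCentre H + Pi.single 0 (t : ℤ) with hxt
  have hx0 : xt 0 = boxCentre H := by rw [hxt]; simp
  have hxT : xt T = boxCentre H + Pi.single 0 (T : ℤ) := rfl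
  have hnear : ∀ t : ℕ, t ≤ T → ∀ m : Fin 4, 8 * |xt t m - (H : ℤ)| ≤ (H : ℤ) := fun t ht m => near_centre_of_le h8T ht m
  -- gradient steps
  have hFb_d₁ : ∀ c x, Fb c x = d₁ (fun z (i : Fin 4) =>
      LatticeMaxwell.glue (pin := fun e => e ∉ dirFreeEdges H) dirCorner (2 * H + 3) (ϑ c)
        (LatticeMaxwell.mean (fun e => e ∉ dirFreeEdges H) dirCorner (2 * H + 3) (ϑ c)) (z, i)) x 1 2 := fun c x => by
    rw [hFb]; exact sCirc_eq_d₁ _ _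
  have hgrad : ∀ c (t : ℕ), t + 1 ≤ T → |Fb c (xt (t + 1)) - Fb c (xt t)| ≤ C * Real.sqrt (Ec c) / (H : ℝ) ^ 3 := by
    intro c t ht
    have h := (hI H hH8 (ϑ c) (s c) (xt t) (hnear t (by omega)) 1 2).2 0
    have hx : xt (t + 1) = xt t + Pi.single 0 1 := by
      show boxCentre H + Pi.single 0 (((t + 1 : ℕ) : ℤ)) = boxCentre H + Pi.single 0 (t : ℤ) + Pi.single 0 1
      rw [Nat.cast_succ, Pi.single_add, add_assoc]
    rw [hFb_d₁, hFb_d₁, hx, hEc]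
    exact h
  have hdiff : ∀ c, |Fb c (xt T) - Fb c (xt 0)| ≤ (T : ℝ) * (C * Real.sqrt (Ec c) / (H : ℝ) ^ 3) :=
    fun c => abs_sub_le_mul_of_steps (fun t => Fb c (xt t)) T _ (fun t ht => hgrad c t ht)
  -- polarisation + gradient: `2βB·CD ≥ −10⁴C²β^{2δ}(T/H)²·CD`
  have hCD0 : 0 ≤ CD := le_trans (div_nonneg hκ'.le (pow_nonneg hTpos.le 4)) hCDlow'
  have hH0 : (H : ℝ) ≠ 0 := hHpos.ne'
  have hgeo : (2 * (H : ℝ) + 3) ^ 4 ≤ 625 * (H : ℝ) ^ 4 := two_mul_add_three_pow_four_le hH1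
  have hE' : ∑ c, Ec c ≤ 16 * (625 * (H : ℝ) ^ 4) * β ^ (2 * δ - 1) := hEsum.trans (by gcongr)
  have hD : ∑ c, (Fb c (xt T) - Fb c (xt 0)) ^ 2 ≤ (T : ℝ) ^ 2 * C ^ 2 * (∑ c, Ec c) / (H : ℝ) ^ 6 := by
    rw [Finset.mul_sum, Finset.sum_div]
    refine Finset.sum_le_sum fun c _ => ?_
    have h := hdiff c
    have hsq : (Fb c (xt T) - Fb c (xt 0)) ^ 2 ≤ ((T : ℝ) * (C * Real.sqrt (Ec c) / (H : ℝ) ^ 3)) ^ 2 := by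
      rw [← sq_abs]; exact pow_le_pow_left₀ (abs_nonneg _) h 2
    refine hsq.trans (le_of_eq ?_)
    have hs : Real.sqrt (Ec c) ^ 2 = Ec c := Real.sq_sqrt (hEc0 c)
    rw [mul_pow, div_pow, mul_pow, hs]
    field_simp
  have h2δ : β ^ (2 * δ) = β * β ^ (2 * δ - 1) := by
    rw [show 2 * δ = 1 + (2 * δ - 1) by ring, Real.rpow_add hβ0, Real.rpow_one]; ring_nf
  have hDle : β * (∑ c, (Fb c (xt T) - Fb c (xt 0)) ^ 2) ≤ 10000 * C ^ 2 * (β ^ (2 * δ) * (T : ℝ) ^ 2 / (H : ℝ) ^ 2) := by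
    have hfrac : (T : ℝ) ^ 2 * C ^ 2 * (∑ c, Ec c) / (H : ℝ) ^ 6 ≤ 10000 * C ^ 2 * β ^ (2 * δ - 1) * (T : ℝ) ^ 2 / (H : ℝ) ^ 2 := by
      rw [div_le_div_iff₀ (pow_pos hHpos 6) (pow_pos hHpos 2)]
      have hTC : 0 ≤ (T : ℝ) ^ 2 * C ^ 2 := mul_nonneg (pow_nonneg hTpos.le 2) (sq_nonneg C)
      have hH6 : 0 ≤ (H : ℝ) ^ 2 := pow_nonneg hHpos.le 2
      calc (T : ℝ) ^ 2 * C ^ 2 * (∑ c, Ec c) * (H : ℝ) ^ 2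
          ≤ (T : ℝ) ^ 2 * C ^ 2 * (16 * (625 * (H : ℝ) ^ 4) * β ^ (2 * δ - 1)) * (H : ℝ) ^ 2 :=
            mul_le_mul_of_nonneg_right (mul_le_mul_of_nonneg_left hE' hTC) hH6
        _ = 10000 * C ^ 2 * β ^ (2 * δ - 1) * (T : ℝ) ^ 2 * (H : ℝ) ^ 6 := by ring
    rw [h2δ]
    calc β * (∑ c, (Fb c (xt T) - Fb c (xt 0)) ^ 2) ≤ β * ((T : ℝ) ^ 2 * C ^ 2 * (∑ c, Ec c) / (H : ℝ) ^ 6) :=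
          mul_le_mul_of_nonneg_left hD hβ0.le
      _ ≤ β * (10000 * C ^ 2 * β ^ (2 * δ - 1) * (T : ℝ) ^ 2 / (H : ℝ) ^ 2) := mul_le_mul_of_nonneg_left hfrac hβ0.le
      _ = 10000 * C ^ 2 * (β * β ^ (2 * δ - 1) * (T : ℝ) ^ 2 / (H : ℝ) ^ 2) := by ring
  have hback : -(10000 * C ^ 2 * (β ^ (2 * δ) * (T : ℝ) ^ 2 / (H : ℝ) ^ 2) * CD) ≤ 2 * β * B * CD := by
    have hpol : -(∑ c, (Fb c (xt T) - Fb c (xt 0)) ^ 2) ≤ 2 * B := by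
      rw [hB, Finset.mul_sum, ← Finset.sum_neg_distrib, hx0, hxT]
      exact Finset.sum_le_sum fun c _ => two_mul_mul_ge_neg_sq _ _
    have h1 : β * (-(∑ c, (Fb c (xt T) - Fb c (xt 0)) ^ 2)) * CD ≤ β * (2 * B) * CD :=
      mul_le_mul_of_nonneg_right (mul_le_mul_of_nonneg_left hpol hβ0.le) hCD0
    have h2 : β * (∑ c, (Fb c (xt T) - Fb c (xt 0)) ^ 2) * CD ≤
        10000 * C ^ 2 * (β ^ (2 * δ) * (T : ℝ) ^ 2 / (H : ℝ) ^ 2) * CD := mul_le_mul_of_nonneg_right hDle hCD0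
    have h3 : β * (-(∑ c, (Fb c (xt T) - Fb c (xt 0)) ^ 2)) * CD = -(β * (∑ c, (Fb c (xt T) - Fb c (xt 0)) ^ 2) * CD) := by ring
    have h4 : β * (2 * B) * CD = 2 * β * B * CD := by ring
    linarith only [h1, h2, h3, h4]
  -- (i) the background term is at most `(3/8)·CD²`
  have hTpow : (T : ℝ) ^ 6 ≤ 64 * β ^ (6 * A) := by
    have h := pow_le_pow_left₀ hTpos.le hT2 6
    have e : (2 * β ^ A) ^ 6 = 64 * β ^ (6 * A) := by
      rw [mul_pow, show (6 : ℝ) * A = A * ((6 : ℕ) : ℝ) by push_cast; ring, Real.rpow_mul_natCast hβ0.le]; norm_num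
    rwa [e] at h
  have hi : 10000 * C ^ 2 * (β ^ (2 * δ) * (T : ℝ) ^ 2 / (H : ℝ) ^ 2) ≤ 3 / 8 * (κ' / (T : ℝ) ^ 4) := by
    have hH2 : β ^ (2 * θ) ≤ (H : ℝ) ^ 2 := by
      have h := pow_le_pow_left₀ (Real.rpow_nonneg hβ0.le θ) hHceil 2
      have e : (β ^ θ) ^ 2 = β ^ (2 * θ) := by
        rw [show (2 : ℝ) * θ = θ * ((2 : ℕ) : ℝ) by push_cast; ring, Real.rpow_mul_natCast hβ0.le]
      rwa [e] at h
    have hexp13 : β ^ (2 * δ) * β ^ (6 * A) * β ^ (13 / 10 * θ) = β ^ (2 * θ) := by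
      rw [← Real.rpow_add hβ0, ← Real.rpow_add hβ0, hδ, hA]; ring_nf
    have hL : 64 * 10000 * C ^ 2 * 8 / (3 * κ') ≤ β ^ (13 / 10 * θ) := by rw [hL₁] at hL₁β; linarith only [hL₁β]
    have hL' : 64 * 10000 * C ^ 2 * 8 ≤ 3 * κ' * β ^ (13 / 10 * θ) := by
      rw [div_le_iff₀ (by positivity)] at hL; linarith only [hL]
    have hT4 : (0 : ℝ) < (T : ℝ) ^ 4 := pow_pos hTpos 4
    have hH2p : (0 : ℝ) < (H : ℝ) ^ 2 := pow_pos hHpos 2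
    -- clear denominators: `X/H² ≤ Y/T⁴ ⇔ X·T⁴ ≤ Y·H²`
    rw [show 10000 * C ^ 2 * (β ^ (2 * δ) * (T : ℝ) ^ 2 / (H : ℝ) ^ 2) = (10000 * C ^ 2 * β ^ (2 * δ) * (T : ℝ) ^ 2) / (H : ℝ) ^ 2
        by ring, show 3 / 8 * (κ' / (T : ℝ) ^ 4) = (3 / 8 * κ') / (T : ℝ) ^ 4 by ring, div_le_div_iff₀ hH2p hT4]
    calc 10000 * C ^ 2 * β ^ (2 * δ) * (T : ℝ) ^ 2 * (T : ℝ) ^ 4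
        = 10000 * C ^ 2 * β ^ (2 * δ) * (T : ℝ) ^ 6 := by ring
      _ ≤ 10000 * C ^ 2 * β ^ (2 * δ) * (64 * β ^ (6 * A)) :=
          mul_le_mul_of_nonneg_left hTpow (mul_nonneg (mul_nonneg (by norm_num) (sq_nonneg C)) (Real.rpow_nonneg hβ0.le _))
      _ = (64 * 10000 * C ^ 2 * 8) * (β ^ (2 * δ) * β ^ (6 * A)) / 8 := by ring
      _ ≤ (3 * κ' * β ^ (13 / 10 * θ)) * (β ^ (2 * δ) * β ^ (6 * A)) / 8 := by
          gcongr
      _ = 3 / 8 * κ' * (β ^ (2 * δ) * β ^ (6 * A) * β ^ (13 / 10 * θ)) := by ring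
      _ = 3 / 8 * κ' * β ^ (2 * θ) := by rw [hexp13]
      _ ≤ 3 / 8 * κ' * (H : ℝ) ^ 2 := mul_le_mul_of_nonneg_left hH2 (by linarith only [hκ'])
  -- (ii) the expansion errors are at most `(3/8)·CD²`
  have hii : 3 / 2 * β ^ (-(θ / 2)) ≤ 3 / 8 * (κ' / (T : ℝ) ^ 4) ^ 2 := by
    have hT8 : (T : ℝ) ^ 8 ≤ 256 * β ^ (8 * A) := by
      have h := pow_le_pow_left₀ hTpos.le hT2 8
      have e : (2 * β ^ A) ^ 8 = 256 * β ^ (8 * A) := by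
        rw [mul_pow, show (8 : ℝ) * A = A * ((8 : ℕ) : ℝ) by push_cast; ring, Real.rpow_mul_natCast hβ0.le]; norm_num
      rwa [e] at h
    have hL : 1024 / κ' ^ 2 ≤ β ^ (θ / 10) := by rw [hL₂] at hL₂β; exact hL₂β
    have hL' : 1024 ≤ κ' ^ 2 * β ^ (θ / 10) := by
      rw [div_le_iff₀ (by positivity)] at hL; linarith only [hL]
    have hexp01 : β ^ (-(θ / 2)) * β ^ (8 * A) * β ^ (θ / 10) = 1 := by
      rw [← Real.rpow_add hβ0, ← Real.rpow_add hβ0, hA]; ring_nf; exact Real.rpow_zero β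
    have hT8p : (0 : ℝ) < ((T : ℝ) ^ 4) ^ 2 := pow_pos (pow_pos hTpos 4) 2
    rw [div_pow, show 3 / 8 * (κ' ^ 2 / ((T : ℝ) ^ 4) ^ 2) = (3 / 8 * κ' ^ 2) / ((T : ℝ) ^ 4) ^ 2 by ring,
      le_div_iff₀ hT8p]
    have hβn : 0 ≤ β ^ (-(θ / 2)) := Real.rpow_nonneg hβ0.le _
    calc 3 / 2 * β ^ (-(θ / 2)) * ((T : ℝ) ^ 4) ^ 2 = 3 / 2 * β ^ (-(θ / 2)) * (T : ℝ) ^ 8 := by ring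
      _ ≤ 3 / 2 * β ^ (-(θ / 2)) * (256 * β ^ (8 * A)) := mul_le_mul_of_nonneg_left hT8 (by linarith only [hβn])
      _ = 3 / 8 * 1024 * (β ^ (-(θ / 2)) * β ^ (8 * A)) := by ring
      _ ≤ 3 / 8 * (κ' ^ 2 * β ^ (θ / 10)) * (β ^ (-(θ / 2)) * β ^ (8 * A)) := by gcongr
      _ = 3 / 8 * κ' ^ 2 * (β ^ (-(θ / 2)) * β ^ (8 * A) * β ^ (θ / 10)) := by ring
      _ = 3 / 8 * κ' ^ 2 := by rw [hexp01, mul_one]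
  -- `CD² ≥ (κ'/T⁴)·CD` and `CD² ≥ (κ'/T⁴)²`
  have hk0 : 0 ≤ κ' / (T : ℝ) ^ 4 := div_nonneg hκ'.le (pow_nonneg hTpos.le 4)
  have hCD2a : κ' / (T : ℝ) ^ 4 * CD ≤ CD ^ 2 := by rw [sq]; exact mul_le_mul_of_nonneg_right hCDlow' hCD0
  have hCD2b : (κ' / (T : ℝ) ^ 4) ^ 2 ≤ CD ^ 2 := pow_le_pow_left₀ hk0 hCDlow' 2
  -- assemble: `(1/2) β² Cov1 ≤ β² Covω`
  have hmain : 1 / 2 * (β ^ 2 * Cov1) ≤ β ^ 2 * Covω := by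
    have e1 : 3 / 2 * CD ^ 2 + 2 * β * B * CD - β ^ (-(θ / 2)) ≤ β ^ 2 * Covω := by
      have := (abs_le.1 hcov').1; linarith only [this]
    have e2 : β ^ 2 * Cov1 ≤ 3 / 2 * CD ^ 2 + β ^ (-(θ / 2)) := by
      have := (abs_le.1 hFβ').2; linarith only [this]
    have hterm1 : 10000 * C ^ 2 * (β ^ (2 * δ) * (T : ℝ) ^ 2 / (H : ℝ) ^ 2) * CD ≤ 3 / 8 * CD ^ 2 := by
      calc 10000 * C ^ 2 * (β ^ (2 * δ) * (T : ℝ) ^ 2 / (H : ℝ) ^ 2) * CD ≤ 3 / 8 * (κ' / (T : ℝ) ^ 4) * CD :=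
            mul_le_mul_of_nonneg_right hi hCD0
        _ = 3 / 8 * (κ' / (T : ℝ) ^ 4 * CD) := by ring
        _ ≤ 3 / 8 * CD ^ 2 := by linarith only [hCD2a]
    have hterm2 : 3 / 2 * β ^ (-(θ / 2)) ≤ 3 / 8 * CD ^ 2 := hii.trans (by linarith only [hCD2b])
    linarith only [e1, e2, hterm1, hterm2, hback]
  -- divide by `β²` and match the statement
  have hβ2 : 0 < β ^ 2 := by positivity
  have hfin : 1 / 2 * Cov1 ≤ Covω := by
    have : β ^ 2 * (1 / 2 * Cov1) ≤ β ^ 2 * Covω := by linarith only [hmain]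
    exact le_of_mul_le_mul_left this hβ2
  rw [hCov1, hCovω] at hfin
  simpa only [hHdef, hTdef, hA, boxKernel] using hfin


/-- **L1a ⇐ `KernelCovExpansion` ∧ `FlatCovExpansion` ∧ `DirKernelTwoPoint`** (the NAMED interfaces of
`Theorems/WeakCouplingRatesBulkDominatesColdBoxWDefs.lean`, appended 2026-08-26): the registered stub `stub_goodBoundaryCovStable` of the line
`dlr-chessboard` follows from the three sub-stubs «kernel covariance expansion along `(A, δ) = (θ/20, θ/5)` below a ceiling», «flat covariance
expansion below a ceiling» and «Coulomb size of the Dirichlet two-point kernel for all `0 < A < θ`». -/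
theorem goodBoundaryCovStable_of_kernelCovExpansion
    (hexp : ∃ θ₂ : ℝ, 0 < θ₂ ∧ ∀ θ : ℝ, 0 < θ → θ ≤ θ₂ → KernelCovExpansion (θ / 20) θ (θ / 5))
    (hflat : ∃ θ₃ : ℝ, 0 < θ₃ ∧ ∀ θ : ℝ, 0 < θ → θ ≤ θ₃ → FlatCovExpansion (θ / 20) θ)
    (hker : ∀ A θ : ℝ, 0 < A → A < θ → DirKernelTwoPoint A θ) :
    ∃ θ₁ : ℝ, 0 < θ₁ ∧ ∀ θ : ℝ, 0 < θ → θ ≤ θ₁ → ∃ η₁ : ℝ, 0 < η₁ ∧ GoodBoundaryCovStable (θ / 20) θ (θ / 5) η₁ := by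
  obtain ⟨θ₂, hθ₂, h₂⟩ := hexp
  obtain ⟨θ₃, hθ₃, h₃⟩ := hflat
  unfold KernelCovExpansion at h₂
  unfold FlatCovExpansion at h₃
  unfold DirKernelTwoPoint at hker
  have hmin : 0 < min θ₂ θ₃ := lt_min hθ₂ hθ₃
  exact goodBoundaryCovStable_of_expansion_explicit hmin
    (fun θ hθ hle => h₂ θ hθ (hle.trans (min_le_left _ _)))
    (fun θ hθ hle => h₃ θ hθ (hle.trans (min_le_right _ _)))
    (fun θ hθ _ => hker (θ / 20) θ (by positivity) (by linarith))

end Summit.QuantumFields.YangMills.Theorems.WeakCouplingRates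

end
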